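import Literature.RingTheory.Smooth.FieldCharP
import Mathlib.RingTheory.Smooth.Basic
import Mathlib.RingTheory.Kaehler.Basic
import Mathlib.Algebra.Algebra.ZMod
import Mathlib.LinearAlgebra.Matrix.NonsingularInverse
import Mathlib.LinearAlgebra.Basis.VectorSpace
import HarnessLib

/-!
# Derivations dual to a regular system of parameters, over the prime field `𝔽_p`
# (Matsumura Thm. 30.6 (ii) without a separability hypothesis)

Topic: `Literature/AlgebraicGeometry/Resolution`. Companion of `SmoothCoordinates.lean` (dual
derivations `δᵢ(uⱼ) = δᵢⱼ` for local rings essentially of finite type and formally smooth over a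
field `k` WITH formally smooth residue field — false over imperfect `k` in general). Here the
base is the PRIME FIELD `𝔽_p`, over which every field is formally smooth (Matsumura Thm. 26.9
with Thm. 26.3; tree: `Literature.RingTheory.Smooth.formallySmooth_of_charP`), and the input is
formal smoothness of the local ring `A` itself over `𝔽_p` (for regular local rings essentially
of finite type over an arbitrary field of characteristic `p` this is
`formallySmooth_zmod_of_isRegularLocalRing_of_essFiniteType`,
`RegularFormallySmoothPrimeField.lean`). Everything is PROVED:

* `exists_derivation_residue_apply_eq` — for `A` local, formally smooth over `𝔽_p`, and
  `u_1, …, u_n ∈ 𝔪` with linearly independent images in `𝔪/𝔪²`: for each `i` an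
  `𝔽_p`-derivation `E : A → A` with `E(uⱼ) ≡ δᵢⱼ (mod 𝔪)` (the conormal map
  `𝔪/𝔪² → κ ⊗ Ω_{A/𝔽_p}` is split injective by Stacks 031I since `κ` is formally smooth over
  `𝔽_p`; compose a retraction with a coordinate functional and lift the resulting
  `Ω_{A/𝔽_p} → κ` to `Ω_{A/𝔽_p} → A`, `Ω_{A/𝔽_p}` being projective);
* `exists_dual_derivations` — **derivations `∂ᵢ ∈ Der_{𝔽_p}(A) = Der(A)` with
  `∂ᵢ(uⱼ) = δᵢⱼ` exactly** (invert the matrix `(Eᵢ(uⱼ))`, which is `≡ 1 (mod 𝔪)`);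
  `exists_dual_derivations_int` — the same as `ℤ`-derivations (Matsumura's `Der(A)`, §25).

## Sources

* H. Matsumura, *Commutative Ring Theory*, CUP 1986: Thm. 30.6 (ii) (p. 240: "there exist
  `D₁, …, Dₙ ∈ Der_k(R)` and `a₁, …, aₙ ∈ R` such that `Dᵢaⱼ = δᵢⱼ`"), Thm. 25.2 (the split
  conormal sequence for a `0`-smooth quotient), Thm. 26.9. [Matsumura1987]
* The Stacks Project, Tag 031I. [StacksProject]
-/

noncomputable section

namespace Literature.AlgebraicGeometry.Resolution

universe u v

open IsLocalRing Module TensorProduct KaehlerDifferential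

section Dual

variable {A : Type u} [CommRing A] [IsLocalRing A]

/-- Evaluation of a finite sum of derivations. [folklore] -/
theorem derivation_sum_apply {R : Type*} [CommSemiring R] {B : Type*} [CommRing B] [Algebra R B]
    {ι : Type*} (s : Finset ι) (F : ι → Derivation R B B) (b : B) :
    (∑ k ∈ s, F k) b = ∑ k ∈ s, F k b := by
  classical
  induction s using Finset.induction_on with
  | empty => simp
  | insert a s ha ih => rw [Finset.sum_insert ha, Finset.sum_insert ha, Derivation.add_apply, ih]

/-- **Derivations over `𝔽_p` dual to independent elements of `𝔪/𝔪²`, modulo `𝔪`.** Let `A` be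
a local ring, formally smooth over `𝔽_p`, with residue field `κ`, and `u : ι → 𝔪` (finite `ι`)
with `κ`-linearly independent images in `𝔪/𝔪²`. Then for each `i` there is an
`𝔽_p`-derivation `E : A → A` with `E(uⱼ) ≡ δᵢⱼ (mod 𝔪)`: as `κ` is formally smooth over `𝔽_p`
(`formallySmooth_of_charP`), `𝔪/𝔪² → κ ⊗_A Ω_{A/𝔽_p}` has a retraction (Stacks 031I,
`Algebra.FormallySmooth.iff_split_injection`); composing it with a coordinate functional gives
`Ω_{A/𝔽_p} → κ`, `duⱼ ↦ δᵢⱼ`, which lifts to `Ω_{A/𝔽_p} → A` since `Ω_{A/𝔽_p}` is projective.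
[cite: Matsumura1987, Thm. 30.6 (ii)] -/
theorem exists_derivation_residue_apply_eq (p : ℕ) [Fact p.Prime] [Algebra (ZMod p) A]
    [Algebra.FormallySmooth (ZMod p) A] {ι : Type v} [Fintype ι] [DecidableEq ι]
    (u : ι → A) (hu : ∀ i, u i ∈ maximalIdeal A)
    (hli : LinearIndependent (ResidueField A) fun i => (maximalIdeal A).toCotangent ⟨u i, hu i⟩)
    (i : ι) :
    ∃ E : Derivation (ZMod p) A A, ∀ j, residue A (E (u j)) = if i = j then 1 else 0 := by
  let κ := ResidueField A
  haveI : CharP κ p := charP_of_injective_algebraMap (algebraMap (ZMod p) κ).injective p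
  have h𝕜 : Algebra.FormallySmooth (ZMod p) κ :=
    Literature.RingTheory.Smooth.formallySmooth_of_charP p κ
  have hsurj : Function.Surjective (algebraMap A κ) := residue_surjective
  -- the ideal `J = ker (A → κ) = 𝔪` and the retraction of the conormal map `J/J² → κ ⊗ Ω`
  let J : Ideal A := RingHom.ker (algebraMap A κ)
  have hJ : J = maximalIdeal A := by
    change RingHom.ker (algebraMap A κ) = _
    rw [ResidueField.algebraMap_eq, ker_residue]
  have hJle : J ≤ (maximalIdeal A).comap (AlgHom.id A A) := fun x hx => by
    simpa [hJ] using hx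
  obtain ⟨l, hl⟩ :
      ∃ l : κ ⊗[A] Ω[A⁄ZMod p] →ₗ[A] J.Cotangent, l ∘ₗ kerCotangentToTensor (ZMod p) A κ = .id :=
    (Algebra.FormallySmooth.iff_split_injection hsurj).mp h𝕜
  -- a coordinate functional on `𝔪/𝔪²`
  obtain ⟨g, hg⟩ := LinearMap.exists_leftInverse_of_injective
    (Fintype.linearCombination κ fun i => (maximalIdeal A).toCotangent ⟨u i, hu i⟩)
    (LinearMap.ker_eq_bot.mpr hli.fintypeLinearCombination_injective)
  have hgu : ∀ j, g ((maximalIdeal A).toCotangent ⟨u j, hu j⟩) = Pi.single j 1 := by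
    intro j
    have := LinearMap.congr_fun hg (Pi.single j 1)
    rwa [LinearMap.comp_apply, Fintype.linearCombination_apply_single, one_smul,
      LinearMap.id_apply] at this
  -- the `A`-linear functional `Ω → κ`, `duⱼ ↦ δᵢⱼ`
  let Φ : Ω[A⁄ZMod p] →ₗ[A] κ :=
    (LinearMap.proj i ∘ₗ g).restrictScalars A ∘ₗ Ideal.mapCotangent J (maximalIdeal A)
      (AlgHom.id A A) hJle ∘ₗ l ∘ₗ (TensorProduct.mk A κ Ω[A⁄ZMod p] 1)
  have hΦ : ∀ j, Φ (D (ZMod p) A (u j)) = if i = j then 1 else 0 := by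
    intro j
    have hjJ : u j ∈ J := by rw [hJ]; exact hu j
    have h1 : l ((1 : κ) ⊗ₜ[A] D (ZMod p) A (u j)) = J.toCotangent ⟨u j, hjJ⟩ := by
      have := LinearMap.congr_fun hl (J.toCotangent ⟨u j, hjJ⟩)
      rw [LinearMap.comp_apply, kerCotangentToTensor_toCotangent, LinearMap.id_apply] at this
      exact this
    change (LinearMap.proj i ∘ₗ g) (Ideal.mapCotangent J (maximalIdeal A) (AlgHom.id A A) hJle
      (l ((1 : κ) ⊗ₜ[A] D (ZMod p) A (u j)))) = _
    rw [h1, Ideal.mapCotangent_toCotangent, LinearMap.comp_apply, LinearMap.proj_apply]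
    change g ((maximalIdeal A).toCotangent ⟨u j, hu j⟩) i = _
    rw [hgu, Pi.single_apply]
  -- lift through `A → κ` (`Ω` is projective)
  obtain ⟨h, hh⟩ := Module.projective_lifting_property (Algebra.linearMap A κ) Φ hsurj
  refine ⟨h.compDer (D (ZMod p) A), fun j => ?_⟩
  have := LinearMap.congr_fun hh (D (ZMod p) A (u j))
  rw [LinearMap.comp_apply, hΦ] at this
  exact this

/-- **Dual derivations over the prime field** (Matsumura Thm. 30.6 (ii), without any hypothesis
on the residue field): for `A` local and formally smooth over `𝔽_p` and `u : ι → 𝔪` with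
linearly independent images in `𝔪/𝔪²` (e.g. a regular system of parameters of a regular local
ring essentially of finite type over a field of characteristic `p`,
`RegularFormallySmoothPrimeField.lean`), there are `𝔽_p`-derivations `∂ᵢ : A → A` with
`∂ᵢ(uⱼ) = δᵢⱼ`. (The matrix `(Eᵢ(uⱼ))` of `exists_derivation_residue_apply_eq` is `≡ 1 (mod 𝔪)`,
hence invertible; multiply by its inverse.) [cite: Matsumura1987, Thm. 30.6 (ii)] -/
theorem exists_dual_derivations (p : ℕ) [Fact p.Prime] [Algebra (ZMod p) A]
    [Algebra.FormallySmooth (ZMod p) A] {ι : Type v} [Fintype ι] [DecidableEq ι]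
    (u : ι → A) (hu : ∀ i, u i ∈ maximalIdeal A)
    (hli : LinearIndependent (ResidueField A) fun i => (maximalIdeal A).toCotangent ⟨u i, hu i⟩) :
    ∃ δ : ι → Derivation (ZMod p) A A, ∀ i j, δ i (u j) = if i = j then 1 else 0 := by
  choose E hE using exists_derivation_residue_apply_eq p u hu hli
  -- the matrix `M i j = E i (u j)` is `≡ 1 (mod 𝔪)`, hence invertible
  let M : Matrix ι ι A := fun i j => E i (u j)
  have hM : M.map (residue A) = 1 := by
    ext i j
    rw [Matrix.map_apply, Matrix.one_apply]
    exact hE i j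
  have hdet : IsUnit M.det := by
    rw [← not_not (a := IsUnit M.det), ← mem_nonunits_iff, ← mem_maximalIdeal,
      ← residue_eq_zero_iff, RingHom.map_det, RingHom.mapMatrix_apply, hM, Matrix.det_one]
    exact one_ne_zero
  refine ⟨fun i => ∑ k, M⁻¹ i k • E k, fun i j => ?_⟩
  rw [derivation_sum_apply]
  simp only [Derivation.smul_apply, smul_eq_mul]
  have : (M⁻¹ * M) i j = if i = j then 1 else 0 := by
    rw [Matrix.nonsing_inv_mul M hdet, Matrix.one_apply]
  rw [← this, Matrix.mul_apply]

/-- `ℤ`-form (Matsumura's `Der(A) = Der_ℤ(A)`, §25): under the hypotheses of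
`exists_dual_derivations` there are derivations `∂ᵢ ∈ Der(A)` with `∂ᵢ(uⱼ) = δᵢⱼ`.
[cite: Matsumura1987, Thm. 30.6 (ii)] -/
theorem exists_dual_derivations_int (p : ℕ) [Fact p.Prime] [Algebra (ZMod p) A]
    [Algebra.FormallySmooth (ZMod p) A] {ι : Type v} [Fintype ι] [DecidableEq ι]
    (u : ι → A) (hu : ∀ i, u i ∈ maximalIdeal A)
    (hli : LinearIndependent (ResidueField A) fun i => (maximalIdeal A).toCotangent ⟨u i, hu i⟩) :
    ∃ δ : ι → Derivation ℤ A A, ∀ i j, δ i (u j) = if i = j then 1 else 0 := by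
  obtain ⟨δ, hδ⟩ := exists_dual_derivations p u hu hli
  exact ⟨fun i => (δ i).restrictScalars ℤ, fun i j => hδ i j⟩

end Dual

end Literature.AlgebraicGeometry.Resolution

end
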